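import Summits.AnomalousDissipation.AnomalousDissipation.Theorems.SawtoothPulseCascadeK1LocalisedCascadeLedgerCascadeH
import Summits.AnomalousDissipation.AnomalousDissipation.Theorems.SawtoothPulseCascadeK1LocalisedCascadeLedgerScheduleFrom
import Summits.AnomalousDissipation.AnomalousDissipation.Theorems.SawtoothPulseCascadeK1LocalisedCascadeLedgerErrorScale

/-!
# K1loc, line `Spectral` / SeqCone — helper: THE H HALF-SLOTS OF THE LEDGER «FROM PHASE i₀», SCALE-EXPLICIT (thin start)

Helper file of the prover lane on the crux `K1LocalisedCascade` (stmt-AnomalousDissipation-19491), route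
`SawtoothPulseCascade` (glue seat k1loc-p3; S-B ↔ S-D hand-over).  `…LedgerCascadeH.exists_geometric_hstepH` instantiates the
concrete H half-slot along the schedule `L_j = L₀ρ(L₀)^j` for all `j ≥ 0` with `L₀ ≥ 1000`; its released set at a hand-over
phase `i₀` is then empty of inviscid cells (hand-over audit, evidence #32).  This file proves the same statement for the
schedule «from phase i₀» of `…LedgerScheduleFrom` — rate `ρ₀ = ρ(L_min)` frozen at a minimal radius `L_min ≥ 1000`, scale
`0 < L₀ ≤ 1` FREE, phases `j ≥ i₀` with `L_min ≤ L₀ρ₀^{i₀}` — with the dependence of the constants on the scale EXPLICIT: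
**`exists_geometric_hstepH_from`** — there are `K_ε, K_ζ ≥ 0` depending only on `(γ, δ₀, L_min, θ₀, B)` such that for every
admissible `(L₀, i₀)`, every `0 < κ ≤ 1`, every classical cascade scalar `w` from `θ₀` and every phase `i₀ ≤ j < J_{γ²−3}(κ)`
the H half-slot inequality holds with `ε ≤ (K_ε/L₀)θ^j`, `ζ ≤ (K_ζ/L₀)θ^j`, `θ = (max(16/ρ₀, 1/2))^{1/4}`.  Proof = the lead's,
with the majorants `…exists_errX/Y_bound` invoked ONCE at the unit scale and transported by `…From.errX_scale / errY_scale`.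
So the closer may take `L₀ = (γ²−3)^{i₀}/(K₀ρ₀^{i₀})` (tracked radius below the deterministic frequency floor of the iterate)
and still sum the errors (`(ρ₀/(γ²−3))·θ < 1`).  No definitions; no statement about the stub.
[cite: ElgindiLissMattingly2025, §1.2.1–§1.2.2 and §3.1] [cite: BedrossianCotiZelati2017, §2] [problem: turb]
-/

-- `Summit.<Summit>.<Problem>`: single-conjunct summit, the duplicate namespace segment is deliberate.
set_option linter.dupNamespace false

noncomputable section

namespace Summit.AnomalousDissipation.AnomalousDissipation.Theorems.SawtoothPulseCascade.K1Ledger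

open MeasureTheory Set Filter Topology UnitAddTorus Function
open Literature.Analysis Literature.Analysis.FunctionSpaces Literature.Analysis.FunctionSpaces.Torus
open Literature.Analysis.FluidPDE.SawtoothCascade Literature.Analysis.FluidPDE.SawtoothCascade.CascadeParams
open Summit.AnomalousDissipation.AnomalousDissipation.Theorems.SawtoothPulseCascade.K1Symbol

section Cascade

variable (P : CascadeParams)

set_option maxHeartbeats 800000 in
/-- **The H half-slots of the cascade ledger «from phase i₀» decay geometrically, with the scale explicit.**  See the module
docstring; the tracked symbols are those of `…LedgerCascadeH` with `ρ(L₀)` replaced by `ρ₀ = ρ(L_min)`.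
[cite: ElgindiLissMattingly2025, §1.2.1–§1.2.2 and §3.1] [cite: BedrossianCotiZelati2017, §2] -/
theorem exists_geometric_hstepH_from (hγ : 5 ≤ P.γ) (hγ' : P.γ ≤ 8) (hδ₀ : 0 < P.δ₀) (hδ₀' : P.δ₀ ≤ 1 / 4)
    (hd : P.d = 2) (hN₀ : P.N₀ = 1) (hρN : P.ρN = 2) {Lm : ℝ} (hLm : 1000 ≤ Lm)
    {θ₀ : UnitAddTorus (Fin 2) → ℝ} {B : ℝ} (hB : ∀ x, |θ₀ x| ≤ B) :
    ∃ Kε Kζ : ℝ, 0 ≤ Kε ∧ 0 ≤ Kζ ∧ ∀ L₀ : ℝ, 0 < L₀ → L₀ ≤ 1 → ∀ i₀ : ℕ,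
      Lm ≤ L₀ * ((P.γ ^ 2 - 5 / 2) / (1 + 1 / 250) ^ 2 - 1 / (2 * (1 + 1 / 250) * Lm)) ^ i₀ → ∀ κ ∈ Ioc (0 : ℝ) 1, ∀ w : ℝ → UnitAddTorus (Fin 2) → ℝ,
      FluidPDE.Torus.IsClassicalScalarTransportOn (Ico 0 1) κ P.field w → w 0 = θ₀ →
        ∀ j : ℕ, i₀ ≤ j → j < Jrate (P.γ ^ 2 - 3) κ → ∃ ε ζ : ℝ, 0 ≤ ε ∧
          ε ≤ Kε / L₀ * Real.sqrt (Real.sqrt (max (16 / ((P.γ ^ 2 - 5 / 2) / (1 + 1 / 250) ^ 2 - 1 / (2 * (1 + 1 / 250) * Lm))) (1 / 2))) ^ j ∧ 0 ≤ ζ ∧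
          ζ ≤ Kζ / L₀ * Real.sqrt (Real.sqrt (max (16 / ((P.γ ^ 2 - 5 / 2) / (1 + 1 / 250) ^ 2 - 1 / (2 * (1 + 1 / 250) * Lm))) (1 / 2))) ^ j ∧
          ∑' k : Fin 2 → ℤ, (1 - Real.smoothTransition ((|((k 0 : ℤ) : ℝ)| -
              L₀ * ((P.γ ^ 2 - 5 / 2) / (1 + 1 / 250) ^ 2 - 1 / (2 * (1 + 1 / 250) * Lm)) ^ j / (1 + 1 / 250)) /
            (1 / 250 * (L₀ * ((P.γ ^ 2 - 5 / 2) / (1 + 1 / 250) ^ 2 - 1 / (2 * (1 + 1 / 250) * Lm)) ^ j / (1 + 1 / 250)))) *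
          (1 - Real.smoothTransition ((P.γ * |((k 1 : ℤ) : ℝ) + P.γ * ((k 0 : ℤ) : ℝ)| - 29 / 20 * |((k 0 : ℤ) : ℝ)|) /
              (1 / 20 * (L₀ * ((P.γ ^ 2 - 5 / 2) / (1 + 1 / 250) ^ 2 - 1 / (2 * (1 + 1 / 250) * Lm)) ^ j / (1 + 1 / 250)))) *
            Real.smoothTransition ((P.γ * |((k 1 : ℤ) : ℝ) - P.γ * ((k 0 : ℤ) : ℝ)| - 29 / 20 * |((k 0 : ℤ) : ℝ)|) /
              (1 / 20 * (L₀ * ((P.γ ^ 2 - 5 / 2) / (1 + 1 / 250) ^ 2 - 1 / (2 * (1 + 1 / 250) * Lm)) ^ j / (1 + 1 / 250))))) *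
        ((1 - Real.smoothTransition ((|((k 0 : ℤ) : ℝ)| -
              ((1 + P.γ) * (2 * L₀ * ((1 + P.γ) ^ 2 + 1) ^ j +
                L₀ * ((P.γ ^ 2 - 5 / 2) / (1 + 1 / 250) ^ 2 - 1 / (2 * (1 + 1 / 250) * Lm)) ^ j / (20 * P.γ * (1 + 1 / 250))) +
                1 / 2)) /
            (L₀ * ((P.γ ^ 2 - 5 / 2) / (1 + 1 / 250) ^ 2 - 1 / (2 * (1 + 1 / 250) * Lm)) ^ j / (20 * P.γ * (1 + 1 / 250))))) *
          (1 - Real.smoothTransition ((|((k 1 : ℤ) : ℝ)| -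
              ((1 + P.γ) * (2 * L₀ * ((1 + P.γ) ^ 2 + 1) ^ j +
                L₀ * ((P.γ ^ 2 - 5 / 2) / (1 + 1 / 250) ^ 2 - 1 / (2 * (1 + 1 / 250) * Lm)) ^ j / (20 * P.γ * (1 + 1 / 250))) +
                1 / 2)) /
            (L₀ * ((P.γ ^ 2 - 5 / 2) / (1 + 1 / 250) ^ 2 - 1 / (2 * (1 + 1 / 250) * Lm)) ^ j / (20 * P.γ * (1 + 1 / 250)))))))
              ^ 2 * ‖mFourierCoeff (fun x => (w (tStart j + tHalf j) x : ℂ)) k‖ ^ 2 ≤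
            (Real.sqrt (∑' k : Fin 2 → ℤ, (1 - Real.smoothTransition ((|((k 0 : ℤ) : ℝ)| - L₀ * ((P.γ ^ 2 - 5 / 2) / (1 + 1 / 250) ^ 2 - 1 / (2 * (1 + 1 / 250) * Lm)) ^ j) /
            (1 / 250 * (L₀ * ((P.γ ^ 2 - 5 / 2) / (1 + 1 / 250) ^ 2 - 1 / (2 * (1 + 1 / 250) * Lm)) ^ j))) *
          (1 - Real.smoothTransition ((P.γ * |((k 1 : ℤ) : ℝ)| - 13 / 10 * |((k 0 : ℤ) : ℝ)|) /
            (1 / 20 * (L₀ * ((P.γ ^ 2 - 5 / 2) / (1 + 1 / 250) ^ 2 - 1 / (2 * (1 + 1 / 250) * Lm)) ^ j)))) *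
        ((1 - Real.smoothTransition ((|((k 0 : ℤ) : ℝ)| - 2 * L₀ * ((1 + P.γ) ^ 2 + 1) ^ j) /
            (L₀ * ((P.γ ^ 2 - 5 / 2) / (1 + 1 / 250) ^ 2 - 1 / (2 * (1 + 1 / 250) * Lm)) ^ j / (20 * P.γ * (1 + 1 / 250))))) *
          (1 - Real.smoothTransition ((|((k 1 : ℤ) : ℝ)| - 2 * L₀ * ((1 + P.γ) ^ 2 + 1) ^ j) /
            (L₀ * ((P.γ ^ 2 - 5 / 2) / (1 + 1 / 250) ^ 2 - 1 / (2 * (1 + 1 / 250) * Lm)) ^ j / (20 * P.γ * (1 + 1 / 250)))))))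
                ^ 2 * ‖mFourierCoeff (fun x => (w (tStart j) x : ℂ)) k‖ ^ 2) + ε) ^ 2 + ζ := by
  -- elementary facts
  have hγ0 : 0 < P.γ := by linarith
  have hLm0 : 0 < Lm := by linarith
  have hd0 : 0 < P.d := by rw [hd]; norm_num
  have hr1 : 1 < (P.γ ^ 2 - 3) := one_lt_rate hγ
  have hrρ : (P.γ ^ 2 - 3) < ((P.γ ^ 2 - 5 / 2) / (1 + 1 / 250) ^ 2 - 1 / (2 * (1 + 1 / 250) * Lm)) := rate_lt_rho hγ hγ' hLm
  have hρ0 : 0 < ((P.γ ^ 2 - 5 / 2) / (1 + 1 / 250) ^ 2 - 1 / (2 * (1 + 1 / 250) * Lm)) := rho_pos hγ hγ' hLm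
  have hr22 : (22 : ℝ) ≤ (P.γ ^ 2 - 3) := by nlinarith
  have hρ16 : 16 < ((P.γ ^ 2 - 5 / 2) / (1 + 1 / 250) ^ 2 - 1 / (2 * (1 + 1 / 250) * Lm)) := by linarith
  have hρr2 : ((P.γ ^ 2 - 5 / 2) / (1 + 1 / 250) ^ 2 - 1 / (2 * (1 + 1 / 250) * Lm)) ≤ (P.γ ^ 2 - 3) ^ 2 := by
    have h1 := rho_le_lambda (γ := P.γ) hLm
    have h2 : (P.γ ^ 2 - 5 / 2) / (1 + 1 / 250) ^ 2 ≤ P.γ ^ 2 - 5 / 2 := div_le_self (by nlinarith) (by norm_num)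
    nlinarith
  have hG2 : 2 ≤ ((1 + P.γ) ^ 2 + 1) := by nlinarith
  have hG1 : 1 ≤ ((1 + P.γ) ^ 2 + 1) := by nlinarith
  obtain ⟨hΘ16, hΘhalf⟩ := le_theta0_sq ((P.γ ^ 2 - 5 / 2) / (1 + 1 / 250) ^ 2 - 1 / (2 * (1 + 1 / 250) * Lm))
  obtain ⟨hΘpos, hΘlt1⟩ := theta0_pos_lt_one hρ16
  obtain ⟨hΘθ, hθ1, hθ0⟩ := theta_facts hρ16
  have hMb0 : 0 ≤ Real.sqrt (2 * Real.log (2000 * ((1 + P.γ) ^ 2 + 1))) := Real.sqrt_nonneg _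
  have hE0 : 0 ≤ FluidPDE.Torus.scalarL2Sq θ₀ := FluidPDE.Torus.scalarL2Sq_nonneg _
  have hB0 : 0 ≤ B := (abs_nonneg _).trans (hB 0)
  -- absolute constants: smooth-step bounds and the two symbol sockets
  obtain ⟨C, hC0, hC₁, hC₂⟩ := Literature.Analysis.Calculus.exists_abs_deriv_and_deriv_deriv_smoothTransition_le
  obtain ⟨CS, hCS0, hS⟩ := exists_fibre_data_symProdS_H
  obtain ⟨CM, hCM0, hM⟩ := exists_fibre_data_symProdM_H_sq
  -- the majorants AT THE UNIT SCALE `L₀ = 1` (uniform constants; the scale enters through `…From.errX_scale`)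
  obtain ⟨AX, hAX0, hAX⟩ := exists_errX_bound (γ := P.γ) (γb := P.γ) (L₀ := 1) (δ₀ := P.δ₀) (C₁ := C) (C₂ := C)
    (Co := CS) (Cn := CM) (Mb := Real.sqrt (2 * Real.log (2000 * ((1 + P.γ) ^ 2 + 1)))) (r := (P.γ ^ 2 - 3)) (ρ := ((P.γ ^ 2 - 5 / 2) / (1 + 1 / 250) ^ 2 - 1 / (2 * (1 + 1 / 250) * Lm)))
    (Θ₀ := Real.sqrt (max (16 / ((P.γ ^ 2 - 5 / 2) / (1 + 1 / 250) ^ 2 - 1 / (2 * (1 + 1 / 250) * Lm))) (1 / 2))) (c := 3 / 1000) hγ0 hγ0 one_pos hδ₀ hC0 hC0 hCS0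
    hCM0 hMb0 (by norm_num) hr1.le hρ0 hρr2 hΘpos.le hΘlt1.le hΘ16 hΘhalf hG2
  obtain ⟨AY, hAY0, hAY⟩ := exists_errY_bound (γb := P.γ) (L₀ := 1) (δ₀ := P.δ₀) (C₁ := C) (C₂ := C) (Cn := CM)
    (Mb := Real.sqrt (2 * Real.log (2000 * ((1 + P.γ) ^ 2 + 1)))) (ρ := ((P.γ ^ 2 - 5 / 2) / (1 + 1 / 250) ^ 2 - 1 / (2 * (1 + 1 / 250) * Lm))) (Θ₀ := Real.sqrt (max (16 / ((P.γ ^ 2 - 5 / 2) / (1 + 1 / 250) ^ 2 - 1 / (2 * (1 + 1 / 250) * Lm))) (1 / 2)))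
    (E₀ := FluidPDE.Torus.scalarL2Sq θ₀) (B := B) hγ0 one_pos hδ₀ hC0 hC0 hCM0 hMb0 hρ0
    hΘpos.le hΘlt1.le hΘ16 hΘhalf hE0 hB0
  obtain ⟨K₀, hK₀0, hK₀⟩ := exists_pow_mul_pow_le hΘpos.le hΘθ 2
  refine ⟨AX * Real.sqrt (FluidPDE.Torus.scalarL2Sq θ₀) * K₀, AY * K₀, by positivity, by positivity, ?_⟩
  intro L₀ hL0 hL1 i₀ hi₀ κ hκ w hw h0 j hij hj
  have hjL : Lm ≤ L₀ * ((P.γ ^ 2 - 5 / 2) / (1 + 1 / 250) ^ 2 - 1 / (2 * (1 + 1 / 250) * Lm)) ^ j := From.le_L_of_le hγ hγ' hLm hL0 hij hi₀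
  -- the phase data
  have hκ0 : 0 < κ := hκ.1
  have hκr : κ * (P.γ ^ 2 - 3) ^ (2 * j) ≤ 1 := kappa_mul_rate_pow_le_one hr1 hκ0 hκ.2 hj
  have hNj : P.N j ≠ 0 := N_ne_zero P hN₀ hρN j
  have hLj := From.L_pos hγ hγ' hLm hL0 j
  have hwj := From.w_pos hγ hγ' hLm hL0 j
  have hRj := From.R_pos (γ := P.γ) hL0 j
  have hR'j := From.R'_pos hγ hγ' hLm hL0 j
  have hB' : ∀ x, |w 0 x| ≤ B := fun x => by rw [h0]; exact hB x
  have hρG : ((P.γ ^ 2 - 5 / 2) / (1 + 1 / 250) ^ 2 - 1 / (2 * (1 + 1 / 250) * Lm)) ^ j ≤ ((1 + P.γ) ^ 2 + 1) ^ j :=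
    pow_le_pow_left₀ hρ0.le (rho_le_Gamma hγ hLm) j
  have hGj : 0 < ((1 + P.γ) ^ 2 + 1) ^ j := by positivity
  -- the envelope radius at scale `L₀` and at the unit scale
  have hRw0 : 0 ≤ 2 * L₀ * ((1 + P.γ) ^ 2 + 1) ^ j + L₀ * ((P.γ ^ 2 - 5 / 2) / (1 + 1 / 250) ^ 2 - 1 / (2 * (1 + 1 / 250) * Lm)) ^ j / (20 * P.γ * (1 + 1 / 250)) := by positivity
  have hRw10 : 0 ≤ 2 * 1 * ((1 + P.γ) ^ 2 + 1) ^ j + 1 * ((P.γ ^ 2 - 5 / 2) / (1 + 1 / 250) ^ 2 - 1 / (2 * (1 + 1 / 250) * Lm)) ^ j / (20 * P.γ * (1 + 1 / 250)) := by positivity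
  have hRwle : 2 * L₀ * ((1 + P.γ) ^ 2 + 1) ^ j + L₀ * ((P.γ ^ 2 - 5 / 2) / (1 + 1 / 250) ^ 2 - 1 / (2 * (1 + 1 / 250) * Lm)) ^ j / (20 * P.γ * (1 + 1 / 250)) ≤
      2 * 1 * ((1 + P.γ) ^ 2 + 1) ^ j + 1 * ((P.γ ^ 2 - 5 / 2) / (1 + 1 / 250) ^ 2 - 1 / (2 * (1 + 1 / 250) * Lm)) ^ j / (20 * P.γ * (1 + 1 / 250)) := by
    have h1 : 2 * L₀ * ((1 + P.γ) ^ 2 + 1) ^ j ≤ 2 * 1 * ((1 + P.γ) ^ 2 + 1) ^ j := by nlinarith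
    have h2 : L₀ * ((P.γ ^ 2 - 5 / 2) / (1 + 1 / 250) ^ 2 - 1 / (2 * (1 + 1 / 250) * Lm)) ^ j / (20 * P.γ * (1 + 1 / 250)) ≤
        1 * ((P.γ ^ 2 - 5 / 2) / (1 + 1 / 250) ^ 2 - 1 / (2 * (1 + 1 / 250) * Lm)) ^ j / (20 * P.γ * (1 + 1 / 250)) :=
      div_le_div_of_nonneg_right (by nlinarith [pow_pos hρ0 j]) (by positivity)
    linarith
  have hRw1 : (2 * 1 * ((1 + P.γ) ^ 2 + 1) ^ j + 1 * ((P.γ ^ 2 - 5 / 2) / (1 + 1 / 250) ^ 2 - 1 / (2 * (1 + 1 / 250) * Lm)) ^ j / (20 * P.γ * (1 + 1 / 250))) *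
      (1 / (1000 * ((1 + P.γ) ^ 2 + 1) ^ j)) ≤ 3 / 1000 := by
    have hw1 : 1 * ((P.γ ^ 2 - 5 / 2) / (1 + 1 / 250) ^ 2 - 1 / (2 * (1 + 1 / 250) * Lm)) ^ j / (20 * P.γ * (1 + 1 / 250)) ≤ 1 * ((1 + P.γ) ^ 2 + 1) ^ j := by
      rw [div_le_iff₀ (by positivity)]
      have h1 : 1 * ((P.γ ^ 2 - 5 / 2) / (1 + 1 / 250) ^ 2 - 1 / (2 * (1 + 1 / 250) * Lm)) ^ j ≤ 1 * ((1 + P.γ) ^ 2 + 1) ^ j := by linarith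
      have h2 : 1 * ((1 + P.γ) ^ 2 + 1) ^ j ≤ 1 * ((1 + P.γ) ^ 2 + 1) ^ j * (20 * P.γ * (1 + 1 / 250)) :=
        le_mul_of_one_le_right (by positivity) (by linarith only [hγ])
      exact h1.trans h2
    calc (2 * 1 * ((1 + P.γ) ^ 2 + 1) ^ j + 1 * ((P.γ ^ 2 - 5 / 2) / (1 + 1 / 250) ^ 2 - 1 / (2 * (1 + 1 / 250) * Lm)) ^ j / (20 * P.γ * (1 + 1 / 250))) * (1 / (1000 * ((1 + P.γ) ^ 2 + 1) ^ j))
        ≤ (3 * 1 * ((1 + P.γ) ^ 2 + 1) ^ j) * (1 / (1000 * ((1 + P.γ) ^ 2 + 1) ^ j)) :=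
          mul_le_mul_of_nonneg_right (by linarith only [hw1]) (by positivity)
      _ = 3 / 1000 := by field_simp
  -- the two majorants at phase `j` (unit scale)
  have hX := hAX j κ (Real.sqrt (2 * Real.log (2000 * ((1 + P.γ) ^ 2 + 1) ^ j)))
    (2 * 1 * ((1 + P.γ) ^ 2 + 1) ^ j + 1 * ((P.γ ^ 2 - 5 / 2) / (1 + 1 / 250) ^ 2 - 1 / (2 * (1 + 1 / 250) * Lm)) ^ j / (20 * P.γ * (1 + 1 / 250))) (tHalf j) _ _ hκ0.le hκr (M_nonneg P.γ j)
    (M_le P.γ j) (M_sq_le P.γ j) hRw10 hRw1 (tHalf_pos j).le (tHalf_le_one j) rfl rfl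
  have hY := hAY j (Real.sqrt (2 * Real.log (2000 * ((1 + P.γ) ^ 2 + 1) ^ j))) _ (M_nonneg P.γ j) (M_le P.γ j)
    (M_sq_le P.γ j) rfl
  have hΦK := hK₀ j
  -- the concrete H half-slot at phase `j` (scale `L₀`)
  have hstep := cascade_ledger_step_H_concrete P hγ0 hδ₀ hd0 j hNj
    (ε := 1 / (1000 * ((1 + P.γ) ^ 2 + 1) ^ j)) (M := Real.sqrt (2 * Real.log (2000 * ((1 + P.γ) ^ 2 + 1) ^ j)))
    (C₁ := C) (C₂ := C) (eps_pos P.γ j) (eps_le_sixth P.γ j) (gamma_mul_eps_le hγ hγ' j) (one_le_M P.γ j)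
    (exp_neg_M_sq_le P.γ j) (M_mul_delta_le P hγ hγ' hδ₀ hδ₀' hd j) hC₁ hC₂
    (c₁ := 2 * C * (Real.sqrt (2 * Real.log (2000 * ((1 + P.γ) ^ 2 + 1) ^ j)) + 4) * (2 * Real.pi * P.N j / P.δ j))
    (c₂ := (4 * C * (Real.sqrt (2 * Real.log (2000 * ((1 + P.γ) ^ 2 + 1) ^ j)) + 4) ^ 2 + 2 * C * (2 * Real.sqrt (2 * Real.log (2000 * ((1 + P.γ) ^ 2 + 1) ^ j)) ^ 2 + 33)) * (2 * Real.pi * P.N j / P.δ j) ^ 2)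
    rfl rfl
    (εs := 1 / 250) (εa := 1 / 20) (a := 13 / 10) (a₂ := 29 / 20) (by norm_num) (by norm_num) hLj hRj hwj hwj hwj
    (From.aperture_H hγ hγ' hLm hL0 j hjL) (From.envelope_H (γ := P.γ) (Lm := Lm) (L₀ := L₀) j) hCS0 hCM0
    (fun n => hS hγ0 (by norm_num) (by norm_num) (by norm_num) hLj hRj hwj hwj (From.w_mul_le_S hγ hγ' hLm hL0 j) le_rfl n)
    (fun n t₀ => hM hγ0.le (by norm_num) (by norm_num) (by norm_num) (div_pos hLj (by norm_num)) hR'j hwj hwj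
      (From.w_mul_le_M (Lm := Lm) (L₀ := L₀) hγ j) le_rfl n t₀)
    hκ0.le hw hB'
  have htH0 : 0 < tHalf j := tHalf_pos j
  have hδj : 0 < P.δ j := P.δ_pos hδ₀ hd0 j
  have hEw : 0 ≤ FluidPDE.Torus.scalarL2Sq (w 0) := FluidPDE.Torus.scalarL2Sq_nonneg _
  have hc₁0 : 0 ≤ 2 * C * (Real.sqrt (2 * Real.log (2000 * ((1 + P.γ) ^ 2 + 1) ^ j)) + 4) * (2 * Real.pi / P.δ₀ * 4 ^ j) := by positivity
  have hc₂0 : 0 ≤ (4 * C * (Real.sqrt (2 * Real.log (2000 * ((1 + P.γ) ^ 2 + 1) ^ j)) + 4) ^ 2 + 2 * C * (2 * Real.sqrt (2 * Real.log (2000 * ((1 + P.γ) ^ 2 + 1) ^ j)) ^ 2 + 33)) * (2 * Real.pi / P.δ₀ * 4 ^ j) ^ 2 := by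
    positivity
  have hL0' : 0 ≤ 1 / L₀ := by positivity
  refine ⟨_, _, ?_, ?_, ?_, ?_, hstep.trans (le_of_eq (add_assoc _ _ _))⟩
  · clear hstep hX hY hΦK hRw1 hRwle hRw0 hRw10 hw hB' hB hAX hAY hK₀ hS hM hC₁ hC₂
    positivity
  · clear hS hM hC₁ hC₂ hAX hAY hK₀
    rw [h0, Lambda_eq P hN₀ hρN hd hδ₀ j]
    refine (mul_le_mul_of_nonneg_right (From.errX_scale hL0 hL1 hγ0.le hγ0 hρ0 hδ₀ hC0 hCS0 hCM0 hκ0.le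
      (M_nonneg P.γ j) htH0.le hc₁0 hc₂0 hRw0 hRwle) (Real.sqrt_nonneg _)).trans ?_
    refine (mul_le_mul_of_nonneg_right (mul_le_mul_of_nonneg_left hX hL0') (Real.sqrt_nonneg _)).trans ?_
    calc 1 / L₀ * (AX * (((j : ℝ) + 1) ^ 2 * Real.sqrt (max (16 / ((P.γ ^ 2 - 5 / 2) / (1 + 1 / 250) ^ 2 - 1 / (2 * (1 + 1 / 250) * Lm))) (1 / 2)) ^ j)) *
          Real.sqrt (FluidPDE.Torus.scalarL2Sq θ₀)
        ≤ 1 / L₀ * (AX * (K₀ * Real.sqrt (Real.sqrt (max (16 / ((P.γ ^ 2 - 5 / 2) / (1 + 1 / 250) ^ 2 - 1 / (2 * (1 + 1 / 250) * Lm))) (1 / 2))) ^ j)) *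
          Real.sqrt (FluidPDE.Torus.scalarL2Sq θ₀) := by gcongr
      _ = _ := by ring
  · clear hstep hX hY hΦK hRw1 hRwle hRw0 hRw10 hw hB' hAX hAY hK₀ hS hM hC₁ hC₂
    positivity
  · clear hS hM hC₁ hC₂ hAX hAY hK₀
    rw [h0, Lambda_eq P hN₀ hρN hd hδ₀ j, delta_eq P hd j]
    refine (From.errY_scale hL0 hL1 hγ0 hρ0 hδ₀ hCM0 (M_nonneg P.γ j) hc₂0 hB0).trans ?_
    refine (mul_le_mul_of_nonneg_left hY hL0').trans ?_
    calc 1 / L₀ * (AY * (((j : ℝ) + 1) ^ 2 * Real.sqrt (max (16 / ((P.γ ^ 2 - 5 / 2) / (1 + 1 / 250) ^ 2 - 1 / (2 * (1 + 1 / 250) * Lm))) (1 / 2)) ^ j))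
        ≤ 1 / L₀ * (AY * (K₀ * Real.sqrt (Real.sqrt (max (16 / ((P.γ ^ 2 - 5 / 2) / (1 + 1 / 250) ^ 2 - 1 / (2 * (1 + 1 / 250) * Lm))) (1 / 2))) ^ j)) := by gcongr
      _ = _ := by ring

end Cascade

end Summit.AnomalousDissipation.AnomalousDissipation.Theorems.SawtoothPulseCascade.K1Ledger
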